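import Mathlib
import HarnessLib
import Literature.MathematicalPhysics.QuantumLattice.KohnLuttinger

/-!
# `stub_klGradient`: the gradient of the nearest-neighbour band

For the square-lattice band `ε₀ = squareDispersion 1 0`,
`ε₀ k = -2 (cos k₀ + cos k₁)` on `Momentum = EuclideanSpace ℝ (Fin 2)`, we prove
`∇ε₀(k) = (2 sin k₀, 2 sin k₁)`: a Fréchet derivative
`L = (2 sin k₀) • proj 0 + (2 sin k₁) • proj 1` is computed by the chain rule, and `L` is the
Riesz dual of the vector `(2 sin k₀, 2 sin k₁)`.
-/

noncomputable section

set_option linter.dupNamespace false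

namespace Summit.HubbardSuperconductivity.HubbardSuperconductivity.Theorems

open MeasureTheory Literature.MathematicalPhysics.QuantumLattice

/-- The nearest-neighbour band is literally `k ↦ -2 (cos k₀ + cos k₁)` (the `t' = 0` term
vanishes). [folklore] -/
theorem kl_gradient_squareDispersion_eq :
    squareDispersion 1 0 = fun k : Momentum => -2 * (Real.cos (k 0) + Real.cos (k 1)) := by
  funext k
  simp only [squareDispersion]
  ring

/-- Chain rule for a coordinate cosine on `EuclideanSpace ℝ (Fin 2)`:
`D(k ↦ cos kᵢ) = (-sin kᵢ) • projᵢ`. [folklore] -/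
theorem kl_gradient_hasFDerivAt_cos_coord (k : Momentum) (i : Fin 2) :
    HasFDerivAt (fun x : Momentum => Real.cos (x i))
      ((-Real.sin (k i)) • (EuclideanSpace.proj i : Momentum →L[ℝ] ℝ)) k := by
  have h1 : HasFDerivAt (𝕜 := ℝ) (fun x : Momentum => x i) (EuclideanSpace.proj i) k :=
    PiLp.hasFDerivAt_apply 2 k i
  exact (Real.hasDerivAt_cos (k i)).comp_hasFDerivAt k h1

/-- The Fréchet derivative of the nearest-neighbour band:
`Dε₀(k) = (2 sin k₀) • proj 0 + (2 sin k₁) • proj 1`. [folklore] -/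
theorem kl_gradient_hasFDerivAt (k : Momentum) :
    HasFDerivAt (squareDispersion 1 0)
      ((2 * Real.sin (k 0)) • (EuclideanSpace.proj 0 : Momentum →L[ℝ] ℝ) +
        (2 * Real.sin (k 1)) • (EuclideanSpace.proj 1 : Momentum →L[ℝ] ℝ)) k := by
  rw [kl_gradient_squareDispersion_eq]
  have h := ((kl_gradient_hasFDerivAt_cos_coord k 0).add
    (kl_gradient_hasFDerivAt_cos_coord k 1)).const_mul (-2)
  refine h.congr_fderiv ?_
  ext v
  simp only [add_apply, smul_apply, smul_eq_mul, smul_add]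
  ring

/-- The Riesz dual of the vector `(a, b) ∈ ℝ²` is the functional `a • proj 0 + b • proj 1`.
[folklore] -/
theorem kl_gradient_toDual_toLp (a b : ℝ) :
    (InnerProductSpace.toDual ℝ Momentum) (WithLp.toLp 2 ![a, b]) =
      a • (EuclideanSpace.proj 0 : Momentum →L[ℝ] ℝ) +
        b • (EuclideanSpace.proj 1 : Momentum →L[ℝ] ℝ) := by
  ext v
  rw [InnerProductSpace.toDual_apply_apply, PiLp.inner_apply, Fin.sum_univ_two]
  simp only [add_apply, smul_apply, smul_eq_mul, EuclideanSpace.coe_proj,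
    Matrix.cons_val_zero, Matrix.cons_val_one, Real.inner_apply]

/-- **Stub `stub_klGradient`**: the gradient of the nearest-neighbour band
`ε₀(k) = -2(cos k₀ + cos k₁)` on `EuclideanSpace ℝ (Fin 2)` is `(2 sin k₀, 2 sin k₁)`. [folklore] -/
theorem stub_klGradient :
    ∀ k : Momentum, gradient (squareDispersion 1 0) k = WithLp.toLp 2 ![2 * Real.sin (k 0), 2 * Real.sin (k 1)] := by
  intro k
  apply HasGradientAt.gradient
  rw [hasGradientAt_iff_hasFDerivAt, kl_gradient_toDual_toLp]
  exact kl_gradient_hasFDerivAt k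

end Summit.HubbardSuperconductivity.HubbardSuperconductivity.Theorems

end
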